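import Summits.Ventures.PercRepro.C025ProfileRankFourLemmas

/-!
# The rank-4 certificate: (Cap)(c), the per-type bounds (night-3 g8)

NIGHT3-G7-RANK4-CERTIFICATE.md §3(c): the weights of the rank-`2` subsets of `S = T₀ ∪ {u}` by `r = ρ(E∖S)`.
* A pair with two extra points: at most `1/3` when `r = 2` (`w4n_le_third_of_sdiff_card_two_of_crk_eq_two`: a
  nonzero entry needs `ρ(E∖B) = 4`).
* The triple `T₀` (one extra point, `|T₀| = 3`, `p₀ = ρ(E∖T₀) ≤ min(4, r + 1)`, weight `p₀/(r + 1 − j₀)`): `0` when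
  `r ≤ 1`; at most `1` when `r = 2`, `j₀ = 0`; at most `3/2` when `r = 2`, `j₀ = 1`; at most `2` when `r ≥ 3`.
* The geometry: a point of the line `cl B` outside `S ⊆ cl B ∪ {u}` forces `r ≥ 2`, two such points force `r ≥ 3`
  (`two_le_crk_of_mem_clF_notMem`, `three_le_crk_of_two_mem_clF_notMem`); and when `r ≤ 2` and a point of the line
  `L = cl T₀` lies outside `S`, every `B` with `S ∖ B ⊆ L` has `ρ(E∖B) ≤ ρ((E∖S) ∪ L) ≤ 2 + 2 − 1 = 3`
  (`crk_le_three_of_sdiff_subset_clF`, submodularity), so the `u`-pairs pay nothing.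
-/

open scoped Matroid

namespace PercRepro

open Set Finset ThmH

section CapCB

variable {α : Type} [DecidableEq α] {M : Matroid α} [M.Finite]

/-- A pair with two extra points is paid at most `1/3` when `ρ(E∖S) = 2`. -/
theorem w4n_le_third_of_sdiff_card_two_of_crk_eq_two {B S : Finset α} (he : (S \ B).card = 2) (hB2 : B.card = 2)
    (hr : crk M S = 2) : w4n M B S ≤ 1 / 3 := by
  rcases le_or_gt 4 (crk M B) with h4 | h4
  · exact w4n_le_third_of_sdiff_card_two_of_four_le_crk he hB2 h4
  · rw [w4n_eq_zero_of_sdiff_card_two_of_crk_ne he hB2 (by omega) (by omega)]; norm_num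

/-- The triple's weight vanishes when `ρ(E∖S) ≤ 1`. -/
theorem w4n_eq_zero_of_sdiff_singleton_of_crk_le_one {B S : Finset α} {y : α} (hy : S \ B = {y})
    (hr : crk M S ≤ 1) : w4n M B S = 0 := by
  have := crk_le_crk_add_one_of_sdiff_singleton (M := M) hy
  exact w4n_eq_zero_of_crk_lt_three (by omega)

/-- The triple's weight is at most `1` when `ρ(E∖S) = 2` and `j = 0`. -/
theorem w4n_le_one_of_sdiff_singleton_of_crk_two_jB_zero {B S : Finset α} {y : α} (hy : S \ B = {y})
    (hB3 : 3 ≤ B.card) (hr : crk M S = 2) (hj : jB M B = 0) : w4n M B S ≤ 1 := by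
  by_cases hp : crk M B < 3
  · rw [w4n_eq_zero_of_crk_lt_three hp]; norm_num
  push Not at hp
  have hpr := crk_le_crk_add_one_of_sdiff_singleton (M := M) hy
  have hsd : (S \ B).card = 1 := by rw [hy, Finset.card_singleton]
  unfold w4n
  rw [w4_of_sdiff_card_one_of_three_le_card hsd hB3 hp, hj, hr]
  apply max_le (by norm_num)
  have : (crk M B : ℚ) ≤ 3 := by
    have h3 : crk M B ≤ 3 := by omega
    exact_mod_cast h3
  push_cast
  rw [div_le_iff₀ (by norm_num)]
  linarith

/-- The triple's weight is at most `3/2` when `ρ(E∖S) = 2` and `j = 1`. -/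
theorem w4n_le_three_halves_of_sdiff_singleton_of_crk_two_jB_one {B S : Finset α} {y : α} (hy : S \ B = {y})
    (hB3 : 3 ≤ B.card) (hr : crk M S = 2) (hj : jB M B = 1) : w4n M B S ≤ 3 / 2 := by
  by_cases hp : crk M B < 3
  · rw [w4n_eq_zero_of_crk_lt_three hp]; norm_num
  push Not at hp
  have hpr := crk_le_crk_add_one_of_sdiff_singleton (M := M) hy
  have hsd : (S \ B).card = 1 := by rw [hy, Finset.card_singleton]
  unfold w4n
  rw [w4_of_sdiff_card_one_of_three_le_card hsd hB3 hp, hj, hr]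
  apply max_le (by norm_num)
  have : (crk M B : ℚ) ≤ 3 := by
    have h3 : crk M B ≤ 3 := by omega
    exact_mod_cast h3
  push_cast
  rw [div_le_iff₀ (by norm_num)]
  linarith

/-- The triple's weight is at most `2` when `ρ(E∖S) ≥ 3` (rank `4`). -/
theorem w4n_le_two_of_sdiff_singleton_of_three_le_crk (hR : M.eRank = (4 : ℕ∞)) {B S : Finset α} {y : α}
    (hy : S \ B = {y}) (hB3 : 3 ≤ B.card) (hr : 3 ≤ crk M S) : w4n M B S ≤ 2 := by
  by_cases hp : crk M B < 3
  · rw [w4n_eq_zero_of_crk_lt_three hp]; norm_num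
  push Not at hp
  have hp4 : crk M B ≤ 4 := crk_le_of_eRank hR B
  have hsd : (S \ B).card = 1 := by rw [hy, Finset.card_singleton]
  have hj2 : jB M B ≤ 2 := by unfold jB; exact min_le_left _ _
  unfold w4n
  rw [w4_of_sdiff_card_one_of_three_le_card hsd hB3 hp]
  apply max_le (by norm_num)
  have hpq : (crk M B : ℚ) ≤ 4 := by exact_mod_cast hp4
  have hrq : (3 : ℚ) ≤ (crk M S : ℚ) := by exact_mod_cast hr
  have hjq : (jB M B : ℚ) ≤ 2 := by exact_mod_cast hj2
  have hpos : (0 : ℚ) < (crk M S : ℚ) + 1 - (jB M B : ℚ) := by linarith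
  rw [div_le_iff₀ hpos]
  linarith

omit [DecidableEq α] in
/-- The rank of the ground set is the rank of `M` (finset form). -/
theorem eRk_gr_eq_eRank' : M.eRk ((gr M : Finset α) : Set α) = M.eRank := by
  rw [coe_gr, M.eRank_def]

/-- A point of the line `cl B` outside `S ⊆ cl B ∪ {u}` forces `ρ(E∖S) ≥ 2` (rank `4`, simple). -/
theorem two_le_crk_of_mem_clF_notMem (hR : M.eRank = (4 : ℕ∞)) (hsimple : ∀ T ⊆ M.E, T.encard ≤ 2 → M.Indep T)
    {B S : Finset α} {u : α} (hB2 : M.eRk (B : Set α) = 2) (hsub : S ⊆ insert u (clF M B)) {z : α}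
    (hz : z ∈ clF M B) (hzS : z ∉ S) : 2 ≤ crk M S := by
  by_contra hr
  push Not at hr
  have hr1 : M.eRk ((gr M \ S : Finset α) : Set α) ≤ 1 := by
    rw [eRk_gr_sdiff_eq_crk]; exact_mod_cast Nat.lt_succ_iff.1 hr
  have hc1 := card_le_one_of_eRk_le_one hsimple Finset.sdiff_subset hr1
  have hzES : z ∈ gr M \ S := Finset.mem_sdiff.2 ⟨clF_subset_gr B hz, hzS⟩
  have hsub' : gr M ⊆ insert u (clF M B) := by
    intro x hx
    by_cases hxS : x ∈ S
    · exact hsub hxS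
    · have : x = z := Finset.card_le_one.1 hc1 x (Finset.mem_sdiff.2 ⟨hx, hxS⟩) z hzES
      rw [this]; exact Finset.mem_insert_of_mem hz
  have : M.eRk ((gr M : Finset α) : Set α) ≤ 3 := by
    calc M.eRk ((gr M : Finset α) : Set α) ≤ M.eRk ((insert u (clF M B) : Finset α) : Set α) :=
          M.eRk_mono (Finset.coe_subset.2 hsub')
      _ ≤ M.eRk ((clF M B : Finset α) : Set α) + 1 := by
          rw [Finset.coe_insert]; exact M.eRk_insert_le_add_one _ _
      _ = 3 := by rw [eRk_clF_of_eRk_two hB2]; rfl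
  rw [eRk_gr_eq_eRank', hR] at this
  exact absurd this (by decide)

/-- Two points of the line `cl B` outside `S ⊆ cl B ∪ {u}` force `ρ(E∖S) ≥ 3` (rank `4`, simple). -/
theorem three_le_crk_of_two_mem_clF_notMem (hR : M.eRank = (4 : ℕ∞)) (hsimple : ∀ T ⊆ M.E, T.encard ≤ 2 → M.Indep T)
    {B S : Finset α} {u : α} (hB2 : M.eRk (B : Set α) = 2) (hsub : S ⊆ insert u (clF M B)) {z z' : α}
    (hzz' : z ≠ z') (hz : z ∈ clF M B) (hz' : z' ∈ clF M B) (hzS : z ∉ S) (hz'S : z' ∉ S) : 3 ≤ crk M S := by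
  by_contra hr
  push Not at hr
  have hr2 : M.eRk ((gr M \ S : Finset α) : Set α) ≤ 2 := by
    rw [eRk_gr_sdiff_eq_crk]; exact_mod_cast Nat.lt_succ_iff.1 hr
  have hzES : z ∈ gr M \ S := Finset.mem_sdiff.2 ⟨clF_subset_gr B hz, hzS⟩
  have hz'ES : z' ∈ gr M \ S := Finset.mem_sdiff.2 ⟨clF_subset_gr B hz', hz'S⟩
  have hline : ((clF M B : Finset α) : Set α) ⊆ M.closure ((gr M \ S : Finset α) : Set α) :=
    clF_subset_closure_of_two_mem hsimple hB2 hzz' hz hz' (by exact_mod_cast hzES) (by exact_mod_cast hz'ES)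
  have hsub' : ((gr M : Finset α) : Set α) ⊆ insert u (M.closure ((gr M \ S : Finset α) : Set α)) := by
    intro x hx
    rw [Finset.mem_coe] at hx
    rw [Set.mem_insert_iff]
    by_cases hxS : x ∈ S
    · have := hsub hxS
      rw [Finset.mem_insert] at this
      rcases this with h | h
      · exact Or.inl h
      · exact Or.inr (hline h)
    · right
      exact M.subset_closure _ (by rw [Finset.coe_sdiff, coe_gr]; exact Set.sdiff_subset)
        (by rw [Finset.mem_coe]; exact Finset.mem_sdiff.2 ⟨hx, hxS⟩)
  have : M.eRk ((gr M : Finset α) : Set α) ≤ 3 := by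
    calc M.eRk ((gr M : Finset α) : Set α)
        ≤ M.eRk (insert u (M.closure ((gr M \ S : Finset α) : Set α))) := M.eRk_mono hsub'
      _ ≤ M.eRk (M.closure ((gr M \ S : Finset α) : Set α)) + 1 := M.eRk_insert_le_add_one _ _
      _ ≤ 2 + 1 := by rw [M.eRk_closure_eq]; exact add_le_add_left hr2 _
      _ = 3 := by norm_num
  rw [eRk_gr_eq_eRank', hR] at this
  exact absurd this (by decide)

/-- If `ρ(E∖S) ≤ 2`, a point `v` of the line `L = cl T₀` lies outside `S`, and `S ∖ B ⊆ L`, then `ρ(E∖B) ≤ 3`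
(submodularity: `ρ((E∖S) ∪ L) ≤ ρ(E∖S) + ρ(L) − ρ((E∖S) ∩ L) ≤ 2 + 2 − 1`). -/
theorem crk_le_three_of_sdiff_subset_clF (hsimple : ∀ T ⊆ M.E, T.encard ≤ 2 → M.Indep T) {B S T₀ : Finset α}
    (hr : crk M S ≤ 2) (hT₀2 : M.eRk (T₀ : Set α) = 2) {v : α} (hv : v ∈ clF M T₀) (hvS : v ∉ S)
    (hsub : S \ B ⊆ clF M T₀) : crk M B ≤ 3 := by
  set X : Set α := ((gr M \ S : Finset α) : Set α) with hX
  set Y : Set α := ((clF M T₀ : Finset α) : Set α) with hY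
  have hXr : M.eRk X ≤ 2 := by rw [hX, eRk_gr_sdiff_eq_crk]; exact_mod_cast hr
  have hYr : M.eRk Y = 2 := eRk_clF_of_eRk_two hT₀2
  have hvg : v ∈ gr M := clF_subset_gr T₀ hv
  have hvE : v ∈ M.E := by rw [← coe_gr]; exact_mod_cast hvg
  have hvXY : v ∈ X ∩ Y := by
    rw [Set.mem_inter_iff, hX, hY, Finset.mem_coe, Finset.mem_coe]
    exact ⟨Finset.mem_sdiff.2 ⟨hvg, hvS⟩, hv⟩
  have hind : M.Indep ({v} : Set α) :=
    hsimple _ (Set.singleton_subset_iff.2 hvE) (by rw [Set.encard_singleton]; exact one_le_two)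
  have hXY1 : (1 : ℕ∞) ≤ M.eRk (X ∩ Y) := by
    calc (1 : ℕ∞) = M.eRk ({v} : Set α) := by rw [hind.eRk_eq_encard, Set.encard_singleton]
      _ ≤ M.eRk (X ∩ Y) := M.eRk_mono (Set.singleton_subset_iff.2 hvXY)
  have hsm := M.eRk_inter_add_eRk_union_le X Y
  have hfin : M.eRk (X ∪ Y) ≠ ⊤ := by
    rw [← lt_top_iff_ne_top]; exact (M.isRkFinite_set _).eRk_lt_top
  obtain ⟨n, hn⟩ := ENat.ne_top_iff_exists.1 hfin
  have hn3 : n ≤ 3 := by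
    have h1 : (1 : ℕ∞) + (n : ℕ∞) ≤ 2 + 2 := by
      calc (1 : ℕ∞) + (n : ℕ∞) ≤ M.eRk (X ∩ Y) + M.eRk (X ∪ Y) := by rw [hn]; exact add_le_add_left hXY1 _
        _ ≤ M.eRk X + M.eRk Y := hsm
        _ ≤ 2 + 2 := by rw [hYr]; exact add_le_add_left hXr _
    have : (1 : ℕ) + n ≤ 2 + 2 := by exact_mod_cast h1
    omega
  -- E ∖ B ⊆ X ∪ Y
  have hBsub : ((gr M \ B : Finset α) : Set α) ⊆ X ∪ Y := by
    intro x hx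
    rw [Finset.mem_coe, Finset.mem_sdiff] at hx
    rw [Set.mem_union, hX, hY, Finset.mem_coe, Finset.mem_coe]
    by_cases hxS : x ∈ S
    · exact Or.inr (hsub (Finset.mem_sdiff.2 ⟨hxS, hx.2⟩))
    · exact Or.inl (Finset.mem_sdiff.2 ⟨hx.1, hxS⟩)
  have h := M.eRk_mono hBsub
  rw [eRk_gr_sdiff_eq_crk, ← hn] at h
  have : crk M B ≤ n := by exact_mod_cast h
  omega

/-- `u` is off the line of `T₀` when `insert u T₀` has rank `3`. -/
theorem notMem_clF_of_insert_eRk_three {T₀ : Finset α} (hT₀g : T₀ ⊆ gr M) (hT₀2 : M.eRk (T₀ : Set α) = 2)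
    {u : α} (h3 : M.eRk ((insert u T₀ : Finset α) : Set α) = 3) : u ∉ clF M T₀ := by
  intro h
  rw [← Finset.mem_coe, coe_clF] at h
  have : M.eRk ((insert u T₀ : Finset α) : Set α) ≤ 2 := by
    calc M.eRk ((insert u T₀ : Finset α) : Set α) ≤ M.eRk (M.closure (T₀ : Set α)) := by
          apply M.eRk_mono
          rw [Finset.coe_insert]
          exact Set.insert_subset h (M.subset_closure _ (by rw [← coe_gr]; exact_mod_cast hT₀g))
      _ = 2 := by rw [M.eRk_closure_eq, hT₀2]
  rw [h3] at this
  exact absurd this (by decide)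

end CapCB

end PercRepro
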